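import Summits.Ventures.CertifiedManyBodySolver.Upper.IntervalReaderGraphEnergy
import Literature.MathematicalPhysics.QuantumLattice.HubbardNNNHoppingOpenClusters

/-!
# Ventures/CertifiedManyBodySolver — Upper/IntervalReaderBoxEnergy.lean: the open `t–t′` BOX read along an enumeration
(part 10 of the Theorem-H1′ package; parts 1–9: `IntervalReaderSchur`, `IntervalReaderTransfer`,
`IntervalReaderH1`, `IntervalReaderBridge`, `IntervalReaderMoments`, `IntervalReaderWitness`,
`IntervalReaderAutomaton`, `IntervalReaderChainEnergy`, `IntervalReaderGraphEnergy`)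

HONEST FRAMING: first certified bounds; not a superconductivity verdict; every number certified or labelled
float.  Pure algebra; no number is certified, no row moves.

The FORMAT-mps1 consumer of the 2-D programme (`Theorems/R2cBoxMpsConsumer.lean`) reads a site-dependent open
MPS `ψ = mpsOpenVar (a·b) A l r` along an enumeration `e : Fin (a·b) ≃ Fin a ×ₗ Fin b` of the open `a × b` box, as
the pulled-back vector `Ψ k = ψ (k ∘ e)`, with certificate sentence
`Re (star Ψ ⬝ᵥ (toSpin (hubbardOpenBoxTT' a b t t′ U) *ᵥ Ψ)) ≤ E · Re (star Ψ ⬝ᵥ Ψ)`.  This file identifies BOTH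
sides with swept contractions of the witness data:

* `star_compEquiv_dotProduct`, `inner_productOp_compEquiv` — relabelling configurations along `e`:
  `star Ψ ⬝ᵥ Ψ′ = star ψ ⬝ᵥ ψ′` and `star Ψ ⬝ᵥ (productOp u *ᵥ Ψ′) = star ψ ⬝ᵥ (productOp (u ∘ e) *ᵥ ψ′)` for every
  bijection `e` (no monotonicity needed: the Jordan–Wigner signs sit inside the families `hopFamily`, defined w.r.t.
  the box's Lex order, and are simply read at the enumerated sites);
* `inner_toSpin_hamiltonian_compEquiv_mpsOpenVar` — for any graph `G` on the box sites:
  `star Ψ ⬝ᵥ (toSpin (hamiltonian G t U) Ψ) = −t Σ_{x,y,σ} [G.Adj x y] S (hopFamily x y σ σ ∘ e) + U Σ_x S ((n_↑n_↓ at x) ∘ e)`,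
  `S O = sweepPairing (a·b) A O l l r r`;
* `inner_toSpin_hubbardOpenBoxTT'_mpsOpenVar` — the `t–t′` box Hamiltonian `hubbardOpenBoxTT' a b t t′ U`
  (`= hamiltonian (rectBoxGraph a b) t U + hamiltonian (rectBoxDiagGraph a b) t′ 0`): nearest-neighbour words
  weighted `−t`, diagonal words weighted `−t′`, on-site words weighted `U`;
* `boxMps_sentence_iff_sweeps` — the consumer's hypothesis `hE` ⇔ the same inequality between these sweeps and the
  norm sweep (part 6).

So for the open-box rows the reader's two numbers ARE the two sides of the certificate sentence, with nothing left
implicit except the evaluation itself (kit) and the enclosure (Theorem H1′, parts 1–3).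
-/

noncomputable section

open Matrix Finset
open scoped BigOperators ComplexOrder

namespace Summit.Ventures.CertifiedManyBodySolver.Upper.IntervalReader

open Literature.MathematicalPhysics.QuantumLattice
open Literature.MathematicalPhysics.QuantumLattice.JordanWigner

/-! ## §R  Relabelling configurations along an enumeration -/

section Relabel

variable {Λ : Type*} [Fintype Λ] [DecidableEq Λ] {q N : ℕ}

/-- Sums over configurations of `Λ` are sums over configurations of `Fin N` after relabelling along
`e : Fin N ≃ Λ` (`k = κ ∘ e⁻¹`). -/
private theorem sum_config_equiv {M : Type*} [AddCommMonoid M] (e : Fin N ≃ Λ) (f : TensorIndex Λ q → M) :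
    ∑ k, f k = ∑ κ : TensorIndex (Fin N) q, f (fun x => κ (e.symm x)) :=
  (Fintype.sum_equiv (Equiv.arrowCongr e (Equiv.refl (Fin q))) (fun κ => f (fun x => κ (e.symm x))) f
    fun _ => rfl).symm

/-- **Norms are unchanged by relabelling**: `star Ψ ⬝ᵥ Ψ′ = star ψ ⬝ᵥ ψ′` for `Ψ k = ψ (k ∘ e)`. -/
theorem star_compEquiv_dotProduct (e : Fin N ≃ Λ) (ψ ψ' : TensorIndex (Fin N) q → ℂ) :
    star (fun k : TensorIndex Λ q => ψ (fun i => k (e i))) ⬝ᵥ (fun k : TensorIndex Λ q => ψ' (fun i => k (e i))) =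
      star ψ ⬝ᵥ ψ' := by
  simp only [dotProduct, Pi.star_apply]
  rw [sum_config_equiv e]
  simp only [Equiv.symm_apply_apply]

/-- **Product operators relabel to product operators**: `star Ψ ⬝ᵥ (productOp u *ᵥ Ψ′) = star ψ ⬝ᵥ (productOp (u ∘ e) *ᵥ ψ′)`
for `Ψ k = ψ (k ∘ e)` and any family `u` on `Λ` — whatever the bijection `e`. -/
theorem inner_productOp_compEquiv (e : Fin N ≃ Λ) (u : Λ → Matrix (Fin q) (Fin q) ℂ)
    (ψ ψ' : TensorIndex (Fin N) q → ℂ) :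
    star (fun k : TensorIndex Λ q => ψ (fun i => k (e i))) ⬝ᵥ
        (productOp u *ᵥ fun k : TensorIndex Λ q => ψ' (fun i => k (e i))) =
      star ψ ⬝ᵥ (productOp (fun i => u (e i)) *ᵥ ψ') := by
  simp only [dotProduct, mulVec, Pi.star_apply, productOp_apply]
  rw [sum_config_equiv e]
  refine Finset.sum_congr rfl fun κ _ => ?_
  simp only [Equiv.symm_apply_apply]
  congr 1
  rw [sum_config_equiv e]
  refine Finset.sum_congr rfl fun κ' _ => ?_
  simp only [Equiv.symm_apply_apply]
  congr 1
  exact (Fintype.prod_equiv e (fun i => u (e i) (κ i) (κ' i)) (fun x => u x (κ (e.symm x)) (κ' (e.symm x)))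
    fun i => by simp only [Equiv.symm_apply_apply]).symm

end Relabel

/-! ## §S  A witness read along an enumeration of a linearly ordered site set -/

section Enumerated

variable {Λ : Type*} [LinearOrder Λ] [Fintype Λ] {D N : ℕ}

/-- **`⟨Ψ|H|Ψ⟩` along an enumeration is a sum of sweeps.**  For a linearly ordered finite site set `Λ` (the
Jordan–Wigner order), any graph `G` on it, an enumeration `e : Fin N ≃ Λ`, and the witness `ψ = mpsOpenVar N A l r`
read as `Ψ k = ψ (k ∘ e)`:
`star Ψ ⬝ᵥ (toSpin (hamiltonian G t U) *ᵥ Ψ) = −t Σ_{x,y,σ} [G.Adj x y] S (hopFamily x y σ σ ∘ e) + U Σ_x S ((n_↑n_↓ at x) ∘ e)`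
with `S O = sweepPairing N A O l l r r`. -/
theorem inner_toSpin_hamiltonian_compEquiv_mpsOpenVar (G : SimpleGraph Λ) [DecidableRel G.Adj] (t U : ℝ)
    (e : Fin N ≃ Λ) (A : Fin N → MPSTensor 4 D) (l r : Fin D → ℂ) :
    star (fun k : TensorIndex Λ 4 => mpsOpenVar N A l r (fun i => k (e i))) ⬝ᵥ
        (toSpin (hamiltonian G t U) *ᵥ fun k : TensorIndex Λ 4 => mpsOpenVar N A l r (fun i => k (e i))) =
      -(t : ℂ) * (∑ x : Λ, ∑ y : Λ, ∑ σ : Fin 2,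
          if G.Adj x y then sweepPairing N A (fun i => hopFamily x y σ σ (e i)) l l r r else 0) +
        (U : ℂ) * ∑ x : Λ, sweepPairing N A
          (fun i => Function.update (fun _ => (1 : Matrix (Fin 4) (Fin 4) ℂ)) x siteDouble (e i)) l l r r := by
  rw [toSpin_hamiltonian_eq_sum_productOp, add_mulVec, dotProduct_add, smul_mulVec, smul_mulVec,
    dotProduct_smul, dotProduct_smul, smul_eq_mul, smul_eq_mul, Matrix.sum_mulVec, dotProduct_sum,
    Matrix.sum_mulVec, dotProduct_sum]
  congr 2
  · refine Finset.sum_congr rfl fun x _ => ?_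
    rw [Matrix.sum_mulVec, dotProduct_sum]
    refine Finset.sum_congr rfl fun y _ => ?_
    rw [Matrix.sum_mulVec, dotProduct_sum]
    refine Finset.sum_congr rfl fun σ _ => ?_
    by_cases hadj : G.Adj x y
    · rw [if_pos hadj, if_pos hadj, inner_productOp_compEquiv, inner_productOp_mpsOpenVar]
    · rw [if_neg hadj, if_neg hadj, zero_mulVec, dotProduct_zero]
  · refine Finset.sum_congr rfl fun x _ => ?_
    rw [inner_productOp_compEquiv, inner_productOp_mpsOpenVar]

end Enumerated

/-! ## §T  The open `t–t′` box of the FORMAT-mps1 rows -/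

section Box

variable {D : ℕ}

/-- **The open `a × b` `t–t′` Hubbard box read along an enumeration.**  For `hubbardOpenBoxTT' a b t t′ U`
`= hamiltonian (rectBoxGraph a b) t U + hamiltonian (rectBoxDiagGraph a b) t′ 0` on `Fin a ×ₗ Fin b` (Lex order = the
Jordan–Wigner order of the tree), an enumeration `e`, and the witness `Ψ k = mpsOpenVar (a·b) A l r (k ∘ e)` of
`Theorems/R2cBoxMpsConsumer.lean`: `star Ψ ⬝ᵥ (toSpin H Ψ)` is `−t ·` (nearest-neighbour hopping sweeps) `+ U ·`
(double-occupancy sweeps) `− t′ ·` (diagonal hopping sweeps). -/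
theorem inner_toSpin_hubbardOpenBoxTT'_mpsOpenVar (a b : ℕ) (t t' U : ℝ) (e : Fin (a * b) ≃ (Fin a ×ₗ Fin b))
    (A : Fin (a * b) → MPSTensor 4 D) (l r : Fin D → ℂ) :
    star (fun k : TensorIndex (Fin a ×ₗ Fin b) 4 => mpsOpenVar (a * b) A l r (fun i => k (e i))) ⬝ᵥ
        (toSpin (hubbardOpenBoxTT' a b t t' U) *ᵥ
          fun k : TensorIndex (Fin a ×ₗ Fin b) 4 => mpsOpenVar (a * b) A l r (fun i => k (e i))) =
      (-(t : ℂ) * (∑ x : Fin a ×ₗ Fin b, ∑ y : Fin a ×ₗ Fin b, ∑ σ : Fin 2,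
          if (rectBoxGraph a b).Adj x y then
            sweepPairing (a * b) A (fun i => hopFamily x y σ σ (e i)) l l r r else 0) +
        (U : ℂ) * ∑ x : Fin a ×ₗ Fin b, sweepPairing (a * b) A
          (fun i => Function.update (fun _ => (1 : Matrix (Fin 4) (Fin 4) ℂ)) x siteDouble (e i)) l l r r) +
      -(t' : ℂ) * (∑ x : Fin a ×ₗ Fin b, ∑ y : Fin a ×ₗ Fin b, ∑ σ : Fin 2,
          if (rectBoxDiagGraph a b).Adj x y then
            sweepPairing (a * b) A (fun i => hopFamily x y σ σ (e i)) l l r r else 0) := by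
  rw [hubbardOpenBoxTT', map_add, add_mulVec, dotProduct_add, inner_toSpin_hamiltonian_compEquiv_mpsOpenVar,
    inner_toSpin_hamiltonian_compEquiv_mpsOpenVar, Complex.ofReal_zero, zero_mul, add_zero]

/-- **The box certificate sentence, unfolded.**  The hypothesis `hE` of `Theorems/R2cBoxMpsConsumer.lean`
(`Re ⟨Ψ, toSpin (hubbardOpenBoxTT' a b t t′ U) Ψ⟩ ≤ E · Re ⟨Ψ, Ψ⟩`) is EQUIVALENT to the same inequality between the
real parts of the swept contractions of the witness data (energy side: `inner_toSpin_hubbardOpenBoxTT'_mpsOpenVar`;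
norm side: `star_compEquiv_dotProduct` + part 6, `= sweepPairing (a·b) A 1 l l r r`).  These two numbers are what
the Theorem-H1′ reader encloses and `accept_sound` compares. -/
theorem boxMps_sentence_iff_sweeps (a b : ℕ) (t t' U E : ℝ) (e : Fin (a * b) ≃ (Fin a ×ₗ Fin b))
    (A : Fin (a * b) → MPSTensor 4 D) (l r : Fin D → ℂ) :
    (star (fun k : TensorIndex (Fin a ×ₗ Fin b) 4 => mpsOpenVar (a * b) A l r (fun i => k (e i))) ⬝ᵥ
          (toSpin (hubbardOpenBoxTT' a b t t' U) *ᵥ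
            fun k : TensorIndex (Fin a ×ₗ Fin b) 4 => mpsOpenVar (a * b) A l r (fun i => k (e i)))).re ≤
        E * (star (fun k : TensorIndex (Fin a ×ₗ Fin b) 4 => mpsOpenVar (a * b) A l r (fun i => k (e i))) ⬝ᵥ
          fun k : TensorIndex (Fin a ×ₗ Fin b) 4 => mpsOpenVar (a * b) A l r (fun i => k (e i))).re ↔
      ((-(t : ℂ) * (∑ x : Fin a ×ₗ Fin b, ∑ y : Fin a ×ₗ Fin b, ∑ σ : Fin 2,
            if (rectBoxGraph a b).Adj x y then
              sweepPairing (a * b) A (fun i => hopFamily x y σ σ (e i)) l l r r else 0) +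
          (U : ℂ) * ∑ x : Fin a ×ₗ Fin b, sweepPairing (a * b) A
            (fun i => Function.update (fun _ => (1 : Matrix (Fin 4) (Fin 4) ℂ)) x siteDouble (e i)) l l r r) +
        -(t' : ℂ) * (∑ x : Fin a ×ₗ Fin b, ∑ y : Fin a ×ₗ Fin b, ∑ σ : Fin 2,
            if (rectBoxDiagGraph a b).Adj x y then
              sweepPairing (a * b) A (fun i => hopFamily x y σ σ (e i)) l l r r else 0)).re ≤
        E * (sweepPairing (a * b) A (fun _ => (1 : Matrix (Fin 4) (Fin 4) ℂ)) l l r r).re := by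
  rw [inner_toSpin_hubbardOpenBoxTT'_mpsOpenVar, star_compEquiv_dotProduct, star_dotProduct_mpsOpenVar_eq_envSweep]
  rfl

end Box

end Summit.Ventures.CertifiedManyBodySolver.Upper.IntervalReader

end
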